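import Summits.CriticalPhenomena.PercolationContinuityZ3.Theorems.PercNearOneGluingNoHeavyPcintNawRandReduction
import HarnessLib

/-!
# PCINT lane, reduction B2c (certificate kind `nawchain_cw`): every incidence of a forced site pays once

Cell `prim-pcint` (PAPER-2 track (iii): certified intervals for `p_c(ℤ^d)`), seat `prim-pcint-2` (gen 3);
memo `run/shared/lean/prim/pcint/REDUCTIONS.md` §B2c.  Does NOT build on p205010.

Same forcing as B2r (`…PcintNawRandForcing`: for every family of sibling orders `o`, the `o`-least open
geodesic word has all its gap sites and bad-corner sites CLOSED), but a different BOOKKEEPING of the factor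
`1 - p` of a forced site `w`: since a self-avoiding word meets `w` at most `2d` times (`card_incTimes_le`),
`1 - p ≤ q^{#incTimes γ w}` whenever `q^{2d} ≥ 1 - p` — every incidence of a forced site is worth one
factor `q = (1-p)^{1/(2d)}` (B2r: one factor `(1-p)^{1/(2d-1)}` per incidence other than the first).
Result (`siteTheta_le_sum_nawChainWeight`):
`θ^site(p) ≤ Σ_{γ NAW} p^{n+1} · q^{incForcedTotal γ} · ((1+q²)/2)^{cornerOnlyTotal γ}`, where
`incForcedTotal` is the total number of incidences of the gap sites of `γ` (the sites forced for every `o`)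
and `cornerOnlyTotal` the number of corners whose corner site is not a gap site (forced with probability
`1/2`, with exactly the two incidences `v_s, v_{s+2}`).  Certificate glue as for B2r.
-/

noncomputable section

namespace Summit.CriticalPhenomena.PercolationContinuityZ3.Theorems.Pcint

open Finset MeasureTheory Literature.Probability.Percolation Literature.Probability.LatticeModels

variable {d n : ℕ}

/-! ### Gap sites, incidence totals, corner-only corners, the B2c weight -/

/-- The GAP SITES of a word: the sites that are a gap event at some time (off-path sites with two incidences
at least three steps apart — closed for every family of sibling orders). [folklore] -/
def gapSites (γ : Fin n → Fin d × Bool) : Finset (Site d) := (range (n + 1)).biUnion (gapSet γ)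

/-- Membership in `gapSites`. [folklore] -/
theorem mem_gapSites {γ : Fin n → Fin d × Bool} {w : Site d} : w ∈ gapSites γ ↔ ∃ t ≤ n, w ∈ gapSet γ t := by
  simp only [gapSites, mem_biUnion, mem_range, Nat.lt_succ_iff]

/-- Total number of incidences of the gap sites (the exponent of `q = (1-p)^{1/(2d)}`). [folklore] -/
def incForcedTotal (γ : Fin n → Fin d × Bool) : ℕ := ∑ w ∈ gapSites γ, (incTimes γ w).card

open Classical in
/-- The CORNER-ONLY corner times: corners whose corner site is not a gap site. [folklore] -/
def cornerOnlyTimes (γ : Fin n → Fin d × Bool) : Finset (Fin n) :=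
  (cornerTimes γ).filter fun s : Fin n => cornerSite γ s ∉ gapSites γ

/-- Number of corner-only corners (the exponent of `(1+q²)/2`). [folklore] -/
def cornerOnlyTotal (γ : Fin n → Fin d × Bool) : ℕ := (cornerOnlyTimes γ).card

/-- The symmetric (order-averaged) B2c weight of a word: `p^{n+1} q^{incForcedTotal} ((1+q²)/2)^{cornerOnlyTotal}`.
[folklore] -/
def nawChainWeight (p q : ℝ) (γ : Fin n → Fin d × Bool) : ℝ :=
  p ^ (n + 1) * q ^ incForcedTotal γ * ((1 + q ^ 2) / 2) ^ cornerOnlyTotal γ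

/-! ### Counting: `(1-p)^{#forced sites} ≤ q^{incForcedTotal} · (q²)^{#bad corner-only corners}` -/

/-- A corner site is adjacent to `v_s`. [folklore] -/
theorem adj_wordPos_cornerSite {γ : Fin n → Fin d × Bool} {s : ℕ} (h : s + 2 ≤ n) :
    (zdGraph d).Adj (wordPos γ s) (cornerSite γ s) := by
  rw [zdGraph_adj_iff_stepVec]
  exact ⟨γ ⟨s + 1, by omega⟩, by rw [cornerSite, dif_pos (by omega : s + 1 < n)]⟩

/-- A corner site is adjacent to `v_{s+2}`. [folklore] -/
theorem adj_wordPos_add_two_cornerSite {γ : Fin n → Fin d × Bool} {s : ℕ} (h : s + 2 ≤ n) :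
    (zdGraph d).Adj (wordPos γ (s + 2)) (cornerSite γ s) := by
  rw [(zdGraph d).adj_comm, zdGraph_adj_iff_stepVec]
  refine ⟨γ ⟨s, by omega⟩, ?_⟩
  rw [show s + 2 = (s + 1) + 1 by ring, wordPos_succ γ (by omega : s + 1 < n), wordPos_succ γ (by omega : s < n),
    cornerSite, dif_pos (by omega : s + 1 < n)]
  abel

/-- A corner site has at least the two incidences `s`, `s + 2`. [folklore] -/
theorem two_le_card_incTimes_cornerSite {γ : Fin n → Fin d × Bool} {s : Fin n} (hs : s ∈ cornerTimes γ) :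
    2 ≤ (incTimes γ (cornerSite γ s)).card := by
  obtain ⟨h, -⟩ := mem_cornerTimes.1 hs
  have h1 : (s : ℕ) ∈ incTimes γ (cornerSite γ s) :=
    mem_filter.2 ⟨mem_range.2 (by omega), adj_wordPos_cornerSite h⟩
  have h2 : (s : ℕ) + 2 ∈ incTimes γ (cornerSite γ s) :=
    mem_filter.2 ⟨mem_range.2 (by omega), adj_wordPos_add_two_cornerSite h⟩
  calc 2 = ({(s : ℕ), (s : ℕ) + 2} : Finset ℕ).card := by rw [card_pair (by omega)]
    _ ≤ (incTimes γ (cornerSite γ s)).card :=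
        card_le_card (fun x hx => by
          rcases mem_insert.1 hx with rfl | hx
          · exact h1
          · rw [mem_singleton.1 hx]; exact h2)

/-- **Distinct corners have distinct corner sites** (a corner site has no incidence older than `v_s`). [folklore] -/
theorem cornerSite_injOn (γ : Fin n → Fin d × Bool) : Set.InjOn (fun s : Fin n => cornerSite γ s) ↑(cornerTimes γ) := by
  intro s hs s' hs' he
  simp only at he
  by_contra hne
  wlog hlt : (s : ℕ) < s' generalizing s s'
  · exact this hs' hs he.symm (Ne.symm hne) (by have := Fin.val_ne_iff.2 hne; omega)
  obtain ⟨h, -, -, hno⟩ := mem_cornerTimes.1 (mem_coe.1 hs')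
  have hadj := adj_wordPos_cornerSite (γ := γ) (mem_cornerTimes.1 (mem_coe.1 hs)).fst
  rw [he] at hadj
  exact hno s (mem_range.2 hlt) hadj

/-- Gap sites are forced sites. [folklore] -/
theorem gapSites_subset_forcedSites (o : Orders d n) (γ : Fin n → Fin d × Bool) : gapSites γ ⊆ forcedSites o γ := by
  intro w hw
  obtain ⟨t, ht, hwt⟩ := mem_gapSites.1 hw
  rw [forcedSites, mem_image]
  refine ⟨(t, w), ?_, rfl⟩
  rw [chargedPairs, mem_union, gapPairs, mem_biUnion]
  exact Or.inl ⟨t, mem_range.2 (by omega), mem_image.2 ⟨w, hwt, rfl⟩⟩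

/-- Bad-corner sites are forced sites. [folklore] -/
theorem cornerSite_mem_forcedSites {o : Orders d n} {γ : Fin n → Fin d × Bool} {s : Fin n} (hs : s ∈ badTimes o γ) :
    cornerSite γ s ∈ forcedSites o γ := by
  rw [forcedSites, mem_image]
  refine ⟨((s : ℕ) + 2, cornerSite γ s), ?_, rfl⟩
  rw [chargedPairs, mem_union, badPairs]
  exact Or.inr (mem_image.2 ⟨s, hs, rfl⟩)

open Classical in
/-- **Counting (B2c).** `(1-p)^{#forced sites} ≤ q^{incForcedTotal} · (q²)^{#bad corner-only corners}` when
`q^{2d} ≥ 1-p`, `0 ≤ q ≤ 1`. [folklore] -/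
theorem pow_card_forcedSites_le_chain {o : Orders d n} {γ : Fin n → Fin d × Bool} (hγ : IsSAW γ) {r q : ℝ}
    (hr0 : 0 ≤ r) (hq0 : 0 ≤ q) (hq1 : q ≤ 1) (hrq : r ≤ q ^ (2 * d)) :
    r ^ (forcedSites o γ).card ≤
      q ^ incForcedTotal γ * (q ^ 2) ^ ((badTimes o γ).filter fun s : Fin n => cornerSite γ s ∉ gapSites γ).card := by
  set F := forcedSites o γ with hF
  set G := gapSites γ with hG
  set BT := (badTimes o γ).filter fun s : Fin n => cornerSite γ s ∉ gapSites γ with hBT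
  set B := BT.image fun s : Fin n => cornerSite γ s with hB
  have hBT_sub : BT ⊆ cornerTimes γ := fun s hs => (mem_badTimes.1 (mem_filter.1 hs).1).1 |> mem_cornerTimes.2
  have hGB : Disjoint G B := by
    rw [disjoint_right]
    intro w hw
    obtain ⟨s, hs, rfl⟩ := mem_image.1 hw
    exact (mem_filter.1 hs).2
  have hsub : G ∪ B ⊆ F := by
    intro w hw
    rcases mem_union.1 hw with hw | hw
    · exact gapSites_subset_forcedSites o γ hw
    · obtain ⟨s, hs, rfl⟩ := mem_image.1 hw
      exact cornerSite_mem_forcedSites (mem_filter.1 hs).1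
  have hcardB : B.card = BT.card :=
    card_image_of_injOn fun s hs s' hs' he => cornerSite_injOn γ (hBT_sub hs) (hBT_sub hs') he
  -- each forced site: r ≤ q^{#incTimes}
  have hfac : ∀ w, r ≤ q ^ (incTimes γ w).card := fun w =>
    hrq.trans (pow_le_pow_of_le_one hq0 hq1 (card_incTimes_le hγ w))
  have hle1 : ∀ w, q ^ (incTimes γ w).card ≤ 1 := fun w => pow_le_one₀ hq0 hq1
  calc r ^ F.card = ∏ _w ∈ F, r := (prod_const _).symm
    _ ≤ ∏ w ∈ F, q ^ (incTimes γ w).card := prod_le_prod (fun _ _ => hr0) fun w _ => hfac w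
    _ = (∏ w ∈ F \ (G ∪ B), q ^ (incTimes γ w).card) * ∏ w ∈ G ∪ B, q ^ (incTimes γ w).card :=
        (prod_sdiff hsub).symm
    _ ≤ 1 * ∏ w ∈ G ∪ B, q ^ (incTimes γ w).card :=
        mul_le_mul_of_nonneg_right (prod_le_one (fun w _ => pow_nonneg hq0 _) fun w _ => hle1 w)
          (prod_nonneg fun w _ => pow_nonneg hq0 _)
    _ = (∏ w ∈ G, q ^ (incTimes γ w).card) * ∏ w ∈ B, q ^ (incTimes γ w).card := by
        rw [one_mul, prod_union hGB]
    _ ≤ (∏ w ∈ G, q ^ (incTimes γ w).card) * ∏ _w ∈ B, q ^ 2 := by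
        refine mul_le_mul_of_nonneg_left (prod_le_prod (fun w _ => pow_nonneg hq0 _) fun w hw => ?_)
          (prod_nonneg fun w _ => pow_nonneg hq0 _)
        obtain ⟨s, hs, rfl⟩ := mem_image.1 hw
        exact pow_le_pow_of_le_one hq0 hq1 (two_le_card_incTimes_cornerSite (hBT_sub hs))
    _ = q ^ incForcedTotal γ * (q ^ 2) ^ BT.card := by
        rw [prod_pow_eq_pow_sum, incForcedTotal, prod_const, hcardB]

/-! ### Averaging over the sibling orders on a sub-family of corners -/

/-- **Averaging on a sub-family of corners.** For a property `P` of corner times not depending on the orders,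
`Σ_o Q^{#(bad corners with P)} = #Orders · ((1+Q)/2)^{#(corners with P)}`. [folklore] -/
theorem sum_orders_pow_card_badTimes_filter (Q : ℝ) (γ : Fin n → Fin d × Bool) (P : Fin n → Prop) [DecidablePred P] :
    ∑ o : Orders d n, Q ^ ((badTimes o γ).filter P).card =
      Fintype.card (Orders d n) * ((1 + Q) / 2) ^ ((cornerTimes γ).filter P).card := by
  classical
  set CT := (cornerTimes γ).filter P with hCT
  have hCTsub : CT ⊆ cornerTimes γ := filter_subset _ _
  set Φ : PNode d n → Equiv.Perm (Fin d × Bool) → ℝ :=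
    fun u σ => ∏ s ∈ CT.filter (fun s => pnode γ s = u), cornerFactor Q γ s σ with hΦ
  have h0 : ∀ o : Orders d n, Q ^ ((badTimes o γ).filter P).card = ∏ s ∈ CT, cornerFactor Q γ s (o (pnode γ s)) := by
    intro o
    have hbf : (badTimes o γ).filter P = CT.filter fun s : Fin n => IsBad o γ s := by
      ext s
      simp only [hCT, mem_filter, mem_badTimes, mem_cornerTimes]
      tauto
    rw [hbf, ← prod_const, prod_filter]
    exact prod_congr rfl fun s _ => (cornerFactor_eq_ite Q o γ s).symm
  have h1 : ∀ o : Orders d n, Q ^ ((badTimes o γ).filter P).card = ∏ u, Φ u (o u) := by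
    intro o
    rw [h0, ← prod_fiberwise CT (pnode γ)]
    refine prod_congr rfl fun u _ => prod_congr rfl fun s hs => ?_
    rw [(mem_filter.1 hs).2]
  have h2 : ∀ u, ∑ σ, Φ u σ = Fintype.card (Equiv.Perm (Fin d × Bool)) *
      (if u ∈ CT.image (pnode γ) then (1 + Q) / 2 else 1) := by
    intro u
    by_cases hu : u ∈ CT.image (pnode γ)
    · rw [if_pos hu]
      obtain ⟨s₀, hs₀, rfl⟩ := mem_image.1 hu
      have hfilter : CT.filter (fun s => pnode γ s = pnode γ s₀) = {s₀} := by
        ext s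
        rw [mem_filter, mem_singleton]
        constructor
        · rintro ⟨-, h⟩; exact pnode_injective γ h
        · rintro rfl; exact ⟨hs₀, rfl⟩
      simp only [hΦ, hfilter, prod_singleton]
      obtain ⟨h, hperp, -, -⟩ := mem_cornerTimes.1 (hCTsub hs₀)
      have hab : γ ⟨s₀, by omega⟩ ≠ γ ⟨s₀ + 1, by omega⟩ := fun he => hperp (congrArg Prod.fst he)
      simp only [cornerFactor, dif_pos h]
      exact sum_perm_cornerCoin Q dirCode dirCode_injective hab
    · rw [if_neg hu, mul_one]
      have hfilter : CT.filter (fun s => pnode γ s = u) = ∅ := by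
        rw [filter_eq_empty_iff]
        intro s hs he
        exact hu (mem_image.2 ⟨s, hs, he⟩)
      simp only [hΦ, hfilter, prod_empty, sum_const, card_univ, nsmul_eq_mul, mul_one]
  simp_rw [h1]
  rw [← Fintype.prod_sum]
  simp_rw [h2]
  rw [prod_mul_distrib, prod_const, card_univ, prod_ite_mem, univ_inter, prod_const,
    card_image_of_injective _ (pnode_injective γ), Fintype.card_fun]
  push_cast
  ring

/-! ### The reduction -/

/-- **Reduction B2c** (certificate kind `nawchain_cw`).  For `0 ≤ q ≤ 1` with `q^{2d} ≥ 1 - p`: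
`θ^site(p) ≤ Σ_{γ ∈ NAW_n} p^{n+1} · q^{incForcedTotal γ} · ((1+q²)/2)^{cornerOnlyTotal γ}` for every `n`.
[folklore] -/
theorem siteTheta_le_sum_nawChainWeight (d n : ℕ) (p : unitInterval) {q : ℝ} (hq0 : 0 ≤ q)
    (hq1 : q ≤ 1) (hpq : 1 - (p : ℝ) ≤ q ^ (2 * d)) :
    siteTheta (zdGraph d) 0 p ≤
      ∑ γ ∈ (sawWords d n).filter (fun w => chordEdges w = ∅), nawChainWeight p q γ := by
  classical
  set NW := (sawWords d n).filter fun w => chordEdges w = ∅ with hNW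
  have hp1 : 0 ≤ 1 - (p : ℝ) := sub_nonneg.2 p.2.2
  have ho : ∀ o : Orders d n, siteTheta (zdGraph d) 0 p ≤
      ∑ γ ∈ NW, (p : ℝ) ^ (n + 1) * q ^ incForcedTotal γ *
        (q ^ 2) ^ ((badTimes o γ).filter fun s : Fin n => cornerSite γ s ∉ gapSites γ).card := by
    intro o
    refine (siteTheta_le_sum_nawRandEvent p o).trans (sum_le_sum fun γ hγ => ?_)
    have hγ' : IsSAW γ := mem_sawWords.1 (mem_filter.1 hγ).1
    rw [mul_assoc]
    exact mul_le_mul_of_nonneg_left (pow_card_forcedSites_le_chain hγ' hp1 hq0 hq1 hpq) (pow_nonneg p.2.1 _)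
  have hO : (0 : ℝ) < Fintype.card (Orders d n) := Nat.cast_pos.2 Fintype.card_pos
  have hsum := sum_le_sum fun (o : Orders d n) (_ : o ∈ univ) => ho o
  rw [sum_const, card_univ, nsmul_eq_mul, sum_comm] at hsum
  have key : ∑ γ ∈ NW, ∑ o : Orders d n, (p : ℝ) ^ (n + 1) * q ^ incForcedTotal γ *
        (q ^ 2) ^ ((badTimes o γ).filter fun s : Fin n => cornerSite γ s ∉ gapSites γ).card
      = Fintype.card (Orders d n) * ∑ γ ∈ NW, nawChainWeight p q γ := by
    rw [mul_sum]
    refine sum_congr rfl fun γ _ => ?_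
    rw [← mul_sum, sum_orders_pow_card_badTimes_filter (q ^ 2) γ (fun s : Fin n => cornerSite γ s ∉ gapSites γ),
      nawChainWeight, cornerOnlyTotal, cornerOnlyTimes]
    ring
  rw [key] at hsum
  exact le_of_mul_le_mul_left hsum hO

/-! ### Certificate glue -/

/-- **Certificate glue (B2c).** If `Σ_{γ ∈ NAW_n} nawChainWeight p q γ ≤ C rⁿ` for all `n` with `r < 1`,
then `θ^site(p) = 0`. [folklore] -/
theorem siteTheta_zd_eq_zero_of_nawChain_le_geometric (d : ℕ) (p : unitInterval) {q C r : ℝ}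
    (hq0 : 0 ≤ q) (hq1 : q ≤ 1) (hpq : 1 - (p : ℝ) ≤ q ^ (2 * d)) (hr0 : 0 ≤ r) (hr : r < 1)
    (h : ∀ n, ∑ γ ∈ (sawWords d n).filter (fun w => chordEdges w = ∅), nawChainWeight p q γ ≤ C * r ^ n) :
    siteTheta (zdGraph d) 0 p = 0 := by
  have ht : Filter.Tendsto (fun n : ℕ => C * r ^ n) Filter.atTop (nhds 0) := by
    simpa using (tendsto_pow_atTop_nhds_zero_of_lt_one hr0 hr).const_mul C
  exact le_antisymm (ge_of_tendsto' ht fun n =>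
    (siteTheta_le_sum_nawChainWeight d n p hq0 hq1 hpq).trans (h n)) measureReal_nonneg

/-- **Certificate glue (B2c), threshold form**: under the same hypothesis, `p ≤ p_c^site(ℤ^d)`. [folklore] -/
theorem le_siteCriticalProb_zd_of_nawChain_le_geometric (d : ℕ) (p : unitInterval) {q C r : ℝ}
    (hq0 : 0 ≤ q) (hq1 : q ≤ 1) (hpq : 1 - (p : ℝ) ≤ q ^ (2 * d)) (hr0 : 0 ≤ r) (hr : r < 1)
    (h : ∀ n, ∑ γ ∈ (sawWords d n).filter (fun w => chordEdges w = ∅), nawChainWeight p q γ ≤ C * r ^ n) :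
    (p : ℝ) ≤ siteCriticalProb (zdGraph d) 0 := by
  have h0 := siteTheta_zd_eq_zero_of_nawChain_le_geometric d p hq0 hq1 hpq hr0 hr h
  refine le_csInf ⟨1, Or.inr rfl⟩ ?_
  rintro r (⟨hr, hθ⟩ | hr)
  · by_contra hlt
    push Not at hlt
    have hmono := siteTheta_mono (G := zdGraph d) (0 : Site d)
      (show (⟨r, hr⟩ : unitInterval) ≤ p from hlt.le)
    exact hθ.not_ge (hmono.trans_eq h0)
  · rw [Set.mem_singleton_iff] at hr
    rw [hr]
    exact p.2.2

end Summit.CriticalPhenomena.PercolationContinuityZ3.Theorems.Pcint
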